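import Summits.SmoothPoincare4.SmoothPoincare4.Theses.LensThinSweepouts
import Literature.Topology.FourManifolds.SimpleBranchedCover
import HarnessLib
import HarnessLib.Audit

/-!
# Birth skeleton (BC3) for crux `LensThinSweepouts.WidthTwoStandard` (item stmt-SmoothPoincare4-7581)

Line `birth` — HYPERELLIPTIC DESCENT: a width-2 sweepout is the lift of a width-0 sweepout through a
2-fold branched covering (Birman–Hilden on the genus-≤2 levels, Montesinos' trick at each critical level),
so R2 splits as DESCENT + RUNG 0 (for the quotient) + SPC4 FOR THIN 2-KNOT DOUBLE COVERS.

R2 = the crux, verbatim the route decl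
`Summit.SmoothPoincare4.SmoothPoincare4.Theses.LensThinSweepouts.WidthTwoStandard` (route
LensThinSweepouts, rank 2, card item R2): for every homotopy 4-sphere `S : HomotopySphere 4` and every Morse
`f : S.carrier → ℝ` injective on its critical set, if every regular level `RegularLevel h` carries a Morse
function with at most 2 critical points of index 1 (total Heegaard genus ≤ 2 — "level-genus width ≤ 2"),
then `S.carrier ≅ S⁴`.

The line factors R2 through the 2-FOLD BRANCHED COVER presentation that the route header foresees
(TWO-LAYER PLAN: `WidthTwoStandard ⇐ HyperellipticDescent → ThinTwoKnotCoversStandard → …`; card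
lens-thin-sweepouts §Mechanism "HYPERELLIPTIC DESCENT"; evidence idea `birman-hilden-lift` on the item),
typed ENTIRELY over tree vocabulary — `HomotopySphere`, `IsMorse`, `criticalSet`, `criticalSetOfIndex`,
`IsRegularLevel`/`RegularLevel` (the crux's own), and the relational predicate
`Literature.Topology.FourManifolds.IsSimpleBranchedCover br ν σ p 2` (SimpleBranchedCover.lean: `p` is a
smooth 2-fold covering branched along the embedded surface `br`, with product tubes `ν`, `σ` in which `p` is
the normal squaring) with branch surface the 2-sphere `𝕊²`:

* STUB A `stub_hyperellipticDescent` — DESCENT (the structure theorem; OPEN, the line's bet): every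
  width-≤2 sweepout `f` of a homotopy 4-sphere `S` is invariant under the deck involution of some smooth
  2-fold covering `p : S → Q` of a homotopy 4-sphere `Q`, branched along a 2-sphere, and `Q` admits a
  width-0 sweepout (all regular levels carry Morse functions with NO index-1 critical point, i.e. are
  disjoint unions of 3-spheres). Mechanism: each genus-≤2 level `Y_t` is a 2-fold cover of `S³` branched
  over a ≤3-bridge link via the hyperelliptic involution of its genus-≤2 Heegaard surface (Birman–Hilden;
  `S¹×S² = Σ₂(2-component unlink)`, `S³ = Σ₂(unknot)`); a 2-handle between genus-≤2 levels along a strongly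
  invertible knot extends the involution (Montesinos' trick), so the involutions assemble to a
  level-preserving involution `τ` of `S`; `S` is an integral homology sphere, so by Smith theory `Fix τ` is a
  mod-2 homology sphere of dimension 2, i.e. a 2-SPHERE with trivial normal bundle (self-intersection 0) —
  hence the product-tube form of `IsSimpleBranchedCover` and `br : 𝕊² → Q` lose nothing; the orbit space
  `Q` is simply connected (Armstrong) with `χ(Q) = (χ(S) + χ(S²))/2 = 2`, a homotopy 4-sphere, swept by the
  quotient levels `Y_t/τ = S³`. The quotient function `f/τ` is NOT smooth at the images of the critical
  points of `f` whose normal Hessian is definite (index 0/4: `|w|² = |u|` in the fold coordinate `u = w²`),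
  which is why the stub asks only that `Q` admit SOME width-0 sweepout `g`, not `g ∘ p = f`.
  It is NOT the crux: it concludes nothing about the diffeomorphism type of `S`.
* STUB B `stub_widthZeroStandard` — RUNG 0 (KNOWN IN KIND, provable now, size L): a homotopy 4-sphere with
  a sweepout all of whose regular levels carry Morse functions without index-1 critical points is
  diffeomorphic to `S⁴` (levels are disjoint unions of `S³`'s; by `H₂`-bookkeeping — Mayer–Vietoris at a
  level with `H₁ = H₂ = 0` — no 2-handle is ever attached, so `S` is assembled from 0/1-handles joining
  components and their duals: boundary-sum trees of balls glued along `S³`, `≅ S⁴` by Cerf `Γ₄ = 0` /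
  Laudenbach–Poenaru with `k = 0`). It is the special case "≤ 0" of the route's sibling crux R1 =
  `WidthOneStandard` (stmt-SmoothPoincare4-10852, "≤ 1") — `WidthOneStandard → Sig.stub_widthZeroStandard`
  is checked below (first `example` of the sanity section) — and of the crux itself ("≤ 2"); it does not give either back.
* STUB C `stub_thinDoubleCoverStandard` — SPC4 FOR SWEEPOUT-THIN 2-KNOT DOUBLE COVERS (OPEN): if a
  homotopy 4-sphere `S` is a smooth 2-fold cover of a STANDARD homotopy sphere `Q ≅ S⁴` branched along a
  2-sphere (a 2-knot `K ⊂ S⁴`), and some width-≤2 sweepout of `S` is constant on the fibres of the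
  covering, then `S ≅ S⁴`. This is the crux RESTRICTED to double branched covers `Σ₂(S⁴, K)` of 2-knots
  whose cross-sections in the descended sweepout are ≤3-bridge links ("bridge-thin"), with the covering
  structure GIVEN: it contains Gordon's theorem that the 2-fold cyclic branched covers of `S⁴` over
  twist-spun knots are standard (Gordon1974/1976, Pao1978, Plotnick1986) and the twisted doubles of Mazur
  manifolds `Σ₂(B⁴, D) ∪ Σ₂(B⁴, D')` (AkbulutKirby1980 doi:10.1007/bf01420118; GabaiNaylorSchwartz2025).
  It is NOT the crux: it needs the covering `p` and the standardness of the quotient as hypotheses (the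
  crux implies it trivially, checked below).

COMPOSITION (kernel-checked, no `sorry` outside the three stubs): `WidthTwoStandard_of :
Sig.stub_hyperellipticDescent → Sig.stub_widthZeroStandard → Sig.stub_thinDoubleCoverStandard →
LensThinSweepouts.WidthTwoStandard` — the crux BY NAME (4 tactic lines: DESCENT gives `Q, p, br, ν, σ` and
the width-0 sweepout `g` of `Q`; RUNG 0 at `(Q, g)` gives `Q ≅ S⁴`; STUB C at `(S, Q, p, …, f)` is the goal);
`widthTwoStandard_of_stubs : WidthTwoStandard := WidthTwoStandard_of stub_A stub_B stub_C` is the wiring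
check (crux closed modulo the registered stubs; `sorryAx` enters only through them). Axioms of
`WidthTwoStandard_of`: propext, Classical.choice, Quot.sound.

DISPROOF USED: no `Disproof.lean` exists for this crux (`ledger crux ls stmt-SmoothPoincare4-7581`: no
workfiles, 2026-08-17); negatives index for SmoothPoincare4: 0 refuted statements (2026-08-17). Refuter /
grounder notes on the item (rreview 935e0e2b, g18-7, g44-6, 2026-08-15): the crux elaborates, simp/aesop
fail, hypotheses satisfiable by `S⁴` with the height function; open problem. No stub drops the binders that
keep the crux non-vacuous (`S : HomotopySphere 4` is compact, nonempty up to the empty-carrier junk handled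
by `nonempty_homotopyEquiv`; the width hypothesis is kept verbatim in A and C).

BARRIERS (route technique classes level-set-3-manifold-width, dehn-surgery-rigidity):
`LowGenusTrisectionBarrier` / `LargeKTrisectionBarrier` — a different, coarser grading (w ≤ g_tris); the
stubs grade levels of a 1-function, not sectors of a 2-function: not engaged. `PropertyTwoRBarrier` /
`StrictPropertyTwoRBarrier` — no stub asserts slide-triviality of an R-link; rung 0 uses no Property R at
all. `CircleActionBarrierFour` / `ProjectiveRigidityBarrierFour` (exotic FREE involutions / fake `ℝP⁴`) —
the involution here has a 2-DIMENSIONAL fixed set and the quotient `Q` is recognised by its own width-0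
sweepout (stub B), never assumed standard: the barrier's examples are exactly why C keeps `Q ≅ S⁴` as a
hypothesis discharged by B. `TwistedSphereBarrierFour` — `Γ₄ = 0` is used positively inside rung 0.
Honest risk (uncatalogued, = the card's own "why DESCENT might fail"): genus-2 surgery transitions along
knots that are NOT strongly invertible (Mattman–Miyazaki–Motegi-type Seifert surgeries; tunnel number 2)
and the cross-level compatibility of hyperelliptic involutions (the genus-2 Goeritz group is larger than
the hyperelliptic centre) — either would refute STUB A on a specific sweepout (possibly of `S⁴` itself)
and send the line back to a restricted DESCENT + an explicit residue stub.
-/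

noncomputable section

open scoped Manifold ContDiff Topology
open Literature.Topology.FourManifolds

namespace Summit.SmoothPoincare4.SmoothPoincare4.Cruxes.WidthTwoStandard.Birth

set_option linter.dupNamespace false
set_option linter.unusedVariables false

/-- Local notation: the round 2-sphere `S² ⊂ ℝ³` (Mathlib manifold structure, model `𝓡 2`) — the
abstract branch / ramification surface of the covering. -/
local notation "𝕊²" => (Metric.sphere (0 : EuclideanSpace ℝ (Fin 3)) 1)

/-- Local notation: the round 4-sphere `S⁴ ⊂ ℝ⁵` (model `𝓡 4`). -/
local notation "𝕊⁴" => (Metric.sphere (0 : EuclideanSpace ℝ (Fin 5)) 1)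

/-! ## Signatures of the three stubs (aliases; the registered `stub_*` theorems below spell them out) -/

namespace Sig

/-- Signature of STUB A (`stub_hyperellipticDescent`): every width-≤2 sweepout `f` of a homotopy
4-sphere `S` is constant on the fibres of a smooth 2-fold covering `p : S → Q` of a homotopy 4-sphere
`Q`, branched along a 2-sphere (`IsSimpleBranchedCover br ν σ p 2`, branch surface `br : 𝕊² → Q`), and
`Q` admits a width-0 sweepout `g` (Morse, injective on its critical set, every regular level carries a
Morse function with no index-1 critical point). -/
abbrev stub_hyperellipticDescent : Prop :=
  ∀ (S : HomotopySphere 4) (f : S.carrier → ℝ), IsMorse (𝓡 4) f →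
    Set.InjOn f (criticalSet (𝓡 4) f) →
    (∀ (t : ℝ) (h : IsRegularLevel (𝓡 4) f t), ∃ g : RegularLevel h → ℝ,
        IsMorse (𝓡 3) g ∧ (criticalSetOfIndex (𝓡 3) g 1).ncard ≤ 2) →
    ∃ (Q : HomotopySphere 4) (p : S.carrier → Q.carrier) (br : 𝕊² → Q.carrier)
      (ν : 𝕊² × ℂ → Q.carrier) (σ : 𝕊² × ℂ → S.carrier),
      IsSimpleBranchedCover br ν σ p 2 ∧ (∀ x y, p x = p y → f x = f y) ∧
      ∃ g : Q.carrier → ℝ, IsMorse (𝓡 4) g ∧ Set.InjOn g (criticalSet (𝓡 4) g) ∧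
        ∀ (t : ℝ) (h : IsRegularLevel (𝓡 4) g t), ∃ g' : RegularLevel h → ℝ,
          IsMorse (𝓡 3) g' ∧ (criticalSetOfIndex (𝓡 3) g' 1).ncard = 0

/-- Signature of STUB B (`stub_widthZeroStandard`, rung 0): a homotopy 4-sphere with a sweepout all of
whose regular levels carry Morse functions without index-1 critical points (levels = disjoint unions of
3-spheres) is diffeomorphic to `S⁴`. -/
abbrev stub_widthZeroStandard : Prop :=
  ∀ (Q : HomotopySphere 4) (g : Q.carrier → ℝ), IsMorse (𝓡 4) g →
    Set.InjOn g (criticalSet (𝓡 4) g) →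
    (∀ (t : ℝ) (h : IsRegularLevel (𝓡 4) g t), ∃ g' : RegularLevel h → ℝ,
        IsMorse (𝓡 3) g' ∧ (criticalSetOfIndex (𝓡 3) g' 1).ncard = 0) →
    Nonempty (Q.carrier ≃ₘ⟮𝓡 4, 𝓡 4⟯ 𝕊⁴)

/-- Signature of STUB C (`stub_thinDoubleCoverStandard`): a homotopy 4-sphere `S` which is a smooth
2-fold cover of a STANDARD homotopy sphere `Q ≅ S⁴` branched along a 2-sphere, with some width-≤2
sweepout `f` of `S` constant on the fibres of the covering, is diffeomorphic to `S⁴`. -/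
abbrev stub_thinDoubleCoverStandard : Prop :=
  ∀ (S Q : HomotopySphere 4) (p : S.carrier → Q.carrier) (br : 𝕊² → Q.carrier)
    (ν : 𝕊² × ℂ → Q.carrier) (σ : 𝕊² × ℂ → S.carrier) (f : S.carrier → ℝ),
    IsSimpleBranchedCover br ν σ p 2 → Nonempty (Q.carrier ≃ₘ⟮𝓡 4, 𝓡 4⟯ 𝕊⁴) →
    IsMorse (𝓡 4) f → Set.InjOn f (criticalSet (𝓡 4) f) →
    (∀ (t : ℝ) (h : IsRegularLevel (𝓡 4) f t), ∃ g : RegularLevel h → ℝ,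
        IsMorse (𝓡 3) g ∧ (criticalSetOfIndex (𝓡 3) g 1).ncard ≤ 2) →
    (∀ x y, p x = p y → f x = f y) →
    Nonempty (S.carrier ≃ₘ⟮𝓡 4, 𝓡 4⟯ 𝕊⁴)

end Sig

/-! ## The three registered stubs (`sorry` lives ONLY here; signatures spelled out over tree declarations) -/

/-- STUB A (registered) — HYPERELLIPTIC DESCENT. For every homotopy 4-sphere `S` and every Morse
`f : S.carrier → ℝ` injective on its critical set with level-genus width ≤ 2, there are a homotopy
4-sphere `Q`, a smooth 2-fold covering `p : S.carrier → Q.carrier` branched along a 2-sphere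
(`IsSimpleBranchedCover br ν σ p 2` with product tubes `ν`, `σ`), such that `f` is constant on the fibres of
`p` (i.e. invariant under the deck involution), and a width-0 sweepout `g` of `Q`. Size: OPEN (structure
theorem; Birman–Hilden + Montesinos' trick level by level, Smith theory for `Fix = S²`, Armstrong for
`π₁(Q) = 1`). Why it might fail: a genus-2 transition along a non-strongly-invertible knot, or incompatible
hyperelliptic involutions across levels. [cite: Montesinos1978 (TAMS 245, doi:10.2307/1998880)]
[cite: BirmanHilden1973] [cite: AkbulutKirby1980 (doi:10.1007/bf01420118)] -/
theorem stub_hyperellipticDescent :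
    ∀ (S : HomotopySphere 4) (f : S.carrier → ℝ), IsMorse (𝓡 4) f →
      Set.InjOn f (criticalSet (𝓡 4) f) →
      (∀ (t : ℝ) (h : IsRegularLevel (𝓡 4) f t), ∃ g : RegularLevel h → ℝ,
          IsMorse (𝓡 3) g ∧ (criticalSetOfIndex (𝓡 3) g 1).ncard ≤ 2) →
      ∃ (Q : HomotopySphere 4) (p : S.carrier → Q.carrier) (br : 𝕊² → Q.carrier)
        (ν : 𝕊² × ℂ → Q.carrier) (σ : 𝕊² × ℂ → S.carrier),
        IsSimpleBranchedCover br ν σ p 2 ∧ (∀ x y, p x = p y → f x = f y) ∧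
        ∃ g : Q.carrier → ℝ, IsMorse (𝓡 4) g ∧ Set.InjOn g (criticalSet (𝓡 4) g) ∧
          ∀ (t : ℝ) (h : IsRegularLevel (𝓡 4) g t), ∃ g' : RegularLevel h → ℝ,
            IsMorse (𝓡 3) g' ∧ (criticalSetOfIndex (𝓡 3) g' 1).ncard = 0 := by
  sorry

/-- STUB B (registered) — RUNG 0 (level-genus width 0 ⇒ standard). For every homotopy 4-sphere `Q` and
every Morse `g : Q.carrier → ℝ` injective on its critical set all of whose regular levels carry a Morse
function with no critical point of index 1 (every level is a disjoint union of 3-spheres: a closed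
3-manifold with a handle decomposition without 1-handles is `⊔ S³`, elementary), `Q.carrier ≅ S⁴`.
Size: L, provable now (Mayer–Vietoris `H₂`-bookkeeping excludes 2-handles; 1- and 3-handles only join/split
components; boundary-sum trees of balls glued along `S³`; Cerf `Γ₄ = 0` / Laudenbach–Poenaru `k = 0`, tree
fact `exists_diffeomorph_comp_incl_eq`). The case "≤ 0" of the sibling crux `WidthOneStandard`
(stmt-SmoothPoincare4-10852). [cite: Cerf1968, Γ₄ = 0] [cite: LaudenbachPoenaru1972]
[cite: Saeki2006 (HMJ 36, doi:10.32917/hmj/1147883401): closed 4-manifolds with sphere-fibred Morse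
functions] -/
theorem stub_widthZeroStandard :
    ∀ (Q : HomotopySphere 4) (g : Q.carrier → ℝ), IsMorse (𝓡 4) g →
      Set.InjOn g (criticalSet (𝓡 4) g) →
      (∀ (t : ℝ) (h : IsRegularLevel (𝓡 4) g t), ∃ g' : RegularLevel h → ℝ,
          IsMorse (𝓡 3) g' ∧ (criticalSetOfIndex (𝓡 3) g' 1).ncard = 0) →
      Nonempty (Q.carrier ≃ₘ⟮𝓡 4, 𝓡 4⟯ 𝕊⁴) := by
  sorry

/-- STUB C (registered) — SPC4 FOR SWEEPOUT-THIN 2-KNOT DOUBLE COVERS. For homotopy 4-spheres `S`, `Q`,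
a smooth 2-fold covering `p : S.carrier → Q.carrier` branched along a 2-sphere (`IsSimpleBranchedCover br ν
σ p 2`), `Q ≅ S⁴`, and a Morse `f : S.carrier → ℝ` injective on its critical set, of level-genus width ≤ 2
and constant on the fibres of `p`: `S.carrier ≅ S⁴`. Equivalently: a homotopy 4-sphere of the form
`Σ₂(S⁴, K)` for a 2-knot `K` with a deck-invariant width-2 sweepout ("bridge-thin cross-sections") is
standard. Size: OPEN (contains Gordon's theorem on cyclic branched covers of twist-spun knots, and the
twisted doubles of Mazur manifolds `Σ₂(B⁴,D) ∪ Σ₂(B⁴,D')`). [cite: Gordon1976] [cite: Plotnick1986]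
[cite: Pao1978] [cite: AkbulutKirby1980 (doi:10.1007/bf01420118)] [cite: GabaiNaylorSchwartz2025] -/
theorem stub_thinDoubleCoverStandard :
    ∀ (S Q : HomotopySphere 4) (p : S.carrier → Q.carrier) (br : 𝕊² → Q.carrier)
      (ν : 𝕊² × ℂ → Q.carrier) (σ : 𝕊² × ℂ → S.carrier) (f : S.carrier → ℝ),
      IsSimpleBranchedCover br ν σ p 2 → Nonempty (Q.carrier ≃ₘ⟮𝓡 4, 𝓡 4⟯ 𝕊⁴) →
      IsMorse (𝓡 4) f → Set.InjOn f (criticalSet (𝓡 4) f) →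
      (∀ (t : ℝ) (h : IsRegularLevel (𝓡 4) f t), ∃ g : RegularLevel h → ℝ,
          IsMorse (𝓡 3) g ∧ (criticalSetOfIndex (𝓡 3) g 1).ncard ≤ 2) →
      (∀ x y, p x = p y → f x = f y) →
      Nonempty (S.carrier ≃ₘ⟮𝓡 4, 𝓡 4⟯ 𝕊⁴) := by
  sorry

/-! ## Composition: stubs ⟹ crux BY NAME (no `sorry` below this line) -/

/-- **`WidthTwoStandard_of` — THE SKELETON THEOREM**: DESCENT, RUNG 0 and SPC4-for-thin-2-knot-double-covers
imply the crux `LensThinSweepouts.WidthTwoStandard` BY NAME. Given the binders of the crux (`S`, `f`, `hf`,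
`hinj`, `hlev`): STUB A gives the covering `p : S → Q` branched along a 2-sphere with `f` constant on its
fibres and a width-0 sweepout `g` of `Q`; STUB B at `(Q, g)` gives `Q ≅ S⁴`; STUB C at
`(S, Q, p, br, ν, σ, f)` is the goal. -/
theorem WidthTwoStandard_of :
    Sig.stub_hyperellipticDescent → Sig.stub_widthZeroStandard → Sig.stub_thinDoubleCoverStandard →
      Summit.SmoothPoincare4.SmoothPoincare4.Theses.LensThinSweepouts.WidthTwoStandard := by
  intro hD hZ hC S f hf hinj hlev
  -- DESCENT: `S → Q` a 2-fold cover branched along a 2-sphere, `f` deck-invariant, `Q` of width 0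
  obtain ⟨Q, p, br, ν, σ, hcov, hfib, g, hg, hginj, hglev⟩ := hD S f hf hinj hlev
  -- RUNG 0: the quotient is the standard sphere
  have hQ : Nonempty (Q.carrier ≃ₘ⟮𝓡 4, 𝓡 4⟯ 𝕊⁴) := hZ Q g hg hginj hglev
  -- thin double branched covers of the standard `S⁴` are standard
  exact hC S Q p br ν σ f hcov hQ hf hinj hlev hfib

/-- Wiring check — the crux BY NAME, closed modulo the three registered stubs (D-0027 §3.3 shape
`<Crux>_proof := crux_of stub₁ stub₂ stub₃`; its axiom closure contains `sorryAx` through the stubs only,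
`WidthTwoStandard_of` itself is sorry-free). Becomes the crux proof when the stubs are discharged. -/
theorem widthTwoStandard_of_stubs :
    Summit.SmoothPoincare4.SmoothPoincare4.Theses.LensThinSweepouts.WidthTwoStandard :=
  WidthTwoStandard_of stub_hyperellipticDescent stub_widthZeroStandard stub_thinDoubleCoverStandard

/-! ## Sanity lemmas (sorry-free): where the stubs sit relative to the route's items -/

/-- The sibling crux R1 = `WidthOneStandard` (stmt-SmoothPoincare4-10852, "≤ 1 index-1 point per level")
implies STUB B ("= 0"): rung 0 is the bottom of the route's ladder, so STUB B closes as soon as R1 does. -/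
example :
    Summit.SmoothPoincare4.SmoothPoincare4.Theses.LensThinSweepouts.WidthOneStandard →
      Sig.stub_widthZeroStandard := by
  intro h Q g hg hinj hlev
  refine h Q g hg hinj fun t hh => ?_
  obtain ⟨g', h1, h2⟩ := hlev t hh
  exact ⟨g', h1, by omega⟩

/-- STUBS B and C are honest WEAKENINGS of the crux (the crux implies each; neither gives it back — BC3
probes `stub → WidthTwoStandard`, `stub → SmoothPoincare4` by `exact? | simpa | unfold; simpa | aesop` all
fail, planner folder `bc/probe_{A,B,C}_{crux,summit}.lean`); STUB A is the structure theorem joining them. -/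
example :
    Summit.SmoothPoincare4.SmoothPoincare4.Theses.LensThinSweepouts.WidthTwoStandard →
      Sig.stub_widthZeroStandard ∧ Sig.stub_thinDoubleCoverStandard := by
  intro h
  refine ⟨fun Q g hg hinj hlev => h Q g hg hinj fun t hh => ?_,
    fun S Q p br ν σ f _ _ hf hinj hlev _ => h S f hf hinj hlev⟩
  obtain ⟨g', h1, h2⟩ := hlev t hh
  exact ⟨g', h1, by omega⟩

/-- BC3 letter, arrow form with the crux BY NAME and the stub signatures as anonymous hypotheses. -/
example :
    Sig.stub_hyperellipticDescent → Sig.stub_widthZeroStandard → Sig.stub_thinDoubleCoverStandard →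
      Summit.SmoothPoincare4.SmoothPoincare4.Theses.LensThinSweepouts.WidthTwoStandard :=
  WidthTwoStandard_of

end Summit.SmoothPoincare4.SmoothPoincare4.Cruxes.WidthTwoStandard.Birth

end
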